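import Mathlib.LinearAlgebra.JordanChevalley
import Literature.AlgebraicGeometry.Motives.MumfordTateInvariantsExp
import Literature.AlgebraicGeometry.Motives.MumfordTateInvariantsTorusElement
import HarnessLib

/-!
# Hodge tensors are the `MT(ℚ)`-invariants; `MT(ℚ)`-stable subspaces are `𝔰`-stable (Mumford–Tate invariants, step 11)

Assembly of the group-theoretic half of `Deligne1982_mumfordTateInvariants`
(`Literature/AlgebraicGeometry/Motives/MumfordTateInvariants.lean`): for a pure `ℚ`-Hodge
structure `H` on a finite-dimensional `V` and its Mumford–Tate group of RATIONAL points
`MT(H)(ℚ) = H.mumfordTateGroup` (the stabiliser of the weight-`0` Hodge tensors of type `(0,0)`):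

* `mem_hodgeClasses_of_forall_mumfordTateGroup` — **a rational tensor fixed by `MT(H)(ℚ)` is a
  Hodge class of type `(0,0)`** (Deligne, *Hodge cycles on abelian varieties*, LNM 900, I,
  Prop. 3.4 with its proof; Green–Griffiths–Kerr (I.B.1): Hodge tensors = MT-invariants);
* `tensorDerivation_apply_mem_of_mumfordTateGroup_stable` — **an `MT(H)(ℚ)`-stable subspace of
  `T^{a,b}` is stable under the Lie algebra `𝔰`** (hence, by `subspaceBaseChange_gradingEnd_stable`,
  a sub-Hodge structure; GGK (I.B.5)).

Proof (replacing the Zariski density of `MT(ℚ)` in `MT`, Borel 18.3, by explicit rational points):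
if `t` is not Hodge, some `X ∈ 𝔰` has `ρ(X) t ≠ 0` (`exists_mem_lieStabilizer_apply_ne_zero`, i.e.
`Θ ∈ 𝔰_ℂ`); by Jordan–Chevalley `X = N + S` with `N, S ∈ 𝔰` (`exists_jordan_mem_lieStabilizer`);
if `ρ(N) t ≠ 0` the unipotent `exp N ∈ MT(ℚ)` moves `t` (`MumfordTateInvariantsExp`), otherwise
the rational torus element through `S` of `exists_torusElement` does. No polarization is needed
for this half.

## References

* P. Deligne, *Hodge cycles on abelian varieties*, LNM 900 (1982), I §3, Prop. 3.4.
* M. Green, P. Griffiths, M. Kerr, *Mumford–Tate groups and domains* (2012), (I.B.1), (I.B.5).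
* A. Borel, *Linear Algebraic Groups*, 2nd ed. (1991), 4.4 (Jordan decomposition), 18.3.
-/

noncomputable section

open scoped TensorProduct
open Polynomial

namespace Literature.AlgebraicGeometry.Motives

universe u v

/-! ### Kernel of `A + B` for commuting `A` (no nilpotent part) and nilpotent `B` -/

section Kernel

variable {K : Type u} [Field K] {M : Type v} [AddCommGroup M] [Module K M]

/-- If `A` and `B` commute, `B` is nilpotent and `ker Aᵏ = ker A` for all `k ≥ 1`, then
`(A + B) t = 0` forces `A t = 0` (and hence `B t = 0`): the kernel of a Jordan decomposition is the
joint kernel. [folklore] -/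
theorem apply_eq_zero_of_add_apply_eq_zero (A B : Module.End K M) (hAB : Commute A B)
    (hB : IsNilpotent B) (hker : ∀ k : ℕ, k ≠ 0 → LinearMap.ker (A ^ k) ≤ LinearMap.ker A) {t : M}
    (h : (A + B) t = 0) : A t = 0 := by
  obtain ⟨m, hm⟩ := hB
  have hAt : A t = -B t := by
    rw [LinearMap.add_apply] at h
    exact eq_neg_of_add_eq_zero_left h
  have hpow : ∀ k : ℕ, (A ^ k) t = (-1 : K) ^ k • (B ^ k) t := by
    intro k
    induction k with
    | zero => simp
    | succ k ih =>
      rw [pow_succ, Module.End.mul_apply, hAt, map_neg, ← Module.End.mul_apply,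
        ← (hAB.symm.pow_right k).eq, Module.End.mul_apply, ih, map_smul, pow_succ (-1 : K) k,
        pow_succ' B k, Module.End.mul_apply, mul_neg_one, neg_smul]
  have h0 : (A ^ (m + 1)) t = 0 := by
    rw [hpow, pow_succ B m, Module.End.mul_apply, hm, LinearMap.zero_apply, smul_zero]
  exact hker (m + 1) (Nat.succ_ne_zero m) h0

/-- Elements of `Algebra.adjoin K {X}` commute with each other (they are polynomials in `X`).
[folklore] -/
theorem commute_of_mem_adjoin_singleton {A : Type v} [Ring A] [Algebra K A] {X N S : A}
    (hN : N ∈ Algebra.adjoin K {X}) (hS : S ∈ Algebra.adjoin K {X}) : Commute N S := by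
  rw [Algebra.adjoin_singleton_eq_range_aeval] at hN hS
  obtain ⟨p, rfl⟩ := hN
  obtain ⟨q, rfl⟩ := hS
  change aeval X p * aeval X q = aeval X q * aeval X p
  rw [← map_mul, ← map_mul, mul_comm]

end Kernel

namespace HodgeStructure

variable {V : Type u} [AddCommGroup V] [Module ℚ V] [Module.Finite ℚ V] [HodgeTensorFacts.{u, u}]
  {n : ℤ}

/-! ### Semisimple elements: no nilpotent part on tensors -/

omit [HodgeTensorFacts.{u, u}] in
/-- For a semisimple `S ∈ End_ℚ V`, the derivation `ρ(S)` on `T^{a,b}` has `ker ρ(S)ᵏ = ker ρ(S)`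
(`ρ(S_ℂ)` is diagonal in the tensor basis of a complex eigenbasis). [folklore] -/
theorem ker_pow_tensorDerivation_le {S : Module.End ℚ V} (hSss : S.IsSemisimple) {a b : ℕ}
    {k : ℕ} (hk : k ≠ 0) :
    LinearMap.ker (tensorDerivation a b S ^ k) ≤ LinearMap.ker (tensorDerivation a b S) := by
  classical
  obtain ⟨ι, _, bb, ev, hbb⟩ := exists_eigenbasis_of_isSemisimple hSss
  intro t ht
  rw [LinearMap.mem_ker] at ht ⊢
  apply tensorSpaceToBaseChange_injective V a b
  have hkk := @ker_pow_eq_ker_of_diag ℂ _ (hodgeTensorSpaceOver ℂ (ℂ ⊗[ℚ] V) a b) _ _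
    ((Fin a → ι) × (Fin b → ι)) (hodgeTensorBasis bb a b) (tensorDerivation a b (S.baseChange ℂ))
    (fun x => (∑ k, ((ev (x.1 k) : ℂ))) - ∑ l, ((ev (x.2 l) : ℂ)))
    (tensorDerivation_hodgeTensorBasis' bb hbb) _ k hk
  rw [map_zero, ← hodgeTensorSpaceBaseChange_one_tmul, ← LinearMap.baseChange_tmul,
    hodgeTensorSpaceBaseChange_tensorDerivation, ← LinearMap.mem_ker, ← hkk, LinearMap.mem_ker,
    ← hodgeTensorSpaceBaseChange_tensorDerivation_pow, ht, TensorProduct.tmul_zero, map_zero]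

/-- **Jordan decomposition inside `𝔰`**: for `X ∈ 𝔰` with Jordan–Chevalley decomposition
`X = N + S` (`N` nilpotent, `S` semisimple, both polynomials in `X`), both `N` and `S` lie in `𝔰`
(the Lie algebra of an algebraic group contains the Jordan parts of its elements; Borel,
*Linear Algebraic Groups*, 4.4(iii) with §7; here: a Hodge tensor killed by `ρ(X) = ρ(S) + ρ(N)`
is killed by `ρ(S)`, since `ρ(S)` has no nilpotent part on tensors). [folklore] -/
theorem exists_jordan_mem_lieStabilizer (H : HodgeStructure V n) {X : Module.End ℚ V}
    (hX : X ∈ H.lieStabilizer) :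
    ∃ N S : Module.End ℚ V, IsNilpotent N ∧ S.IsSemisimple ∧ X = N + S ∧
      N ∈ H.lieStabilizer ∧ S ∈ H.lieStabilizer := by
  obtain ⟨N, hN, S, hS, hNnil, hSss, hXNS⟩ := X.exists_isNilpotent_isSemisimple
  have hcomm : Commute N S := commute_of_mem_adjoin_singleton hN hS
  have hSmem : S ∈ H.lieStabilizer := by
    rw [mem_lieStabilizer_iff] at hX ⊢
    intro a b hab t ht
    have h := hX a b hab t ht
    rw [hXNS, map_add, add_comm] at h
    exact apply_eq_zero_of_add_apply_eq_zero _ _ (commute_tensorDerivation a b hcomm.symm)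
      (isNilpotent_tensorDerivation a b hNnil) (fun k hk => ker_pow_tensorDerivation_le hSss hk) h
  have hNmem : N ∈ H.lieStabilizer := by
    have h : N = X - S := by rw [hXNS, add_sub_cancel_right]
    rw [h]
    exact Submodule.sub_mem _ hX hSmem
  exact ⟨N, S, hNnil, hSss, hXNS, hNmem, hSmem⟩

/-- **Unipotent rational points of `MT`**: for a nilpotent `N ∈ 𝔰`, `exp N ∈ MT(H)(ℚ)`
(it fixes every weight-`0` Hodge tensor, which `ρ(N)` kills). [folklore] -/
theorem unipotentOfNilpotent_mem_mumfordTateGroup (H : HodgeStructure V n) {N : Module.End ℚ V}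
    (hN : N ∈ H.lieStabilizer) (hNnil : IsNilpotent N) :
    unipotentOfNilpotent hNnil ∈ H.mumfordTateGroup := by
  rw [mem_mumfordTateGroup_iff]
  intro a b hab t ht
  exact tensorSpaceAct_unipotent_eq_self hNnil ((H.mem_lieStabilizer_iff N).1 hN a b hab t ht)

/-! ### Hodge tensors = `MT(ℚ)`-invariants -/

/-- **A rational tensor fixed by the Mumford–Tate group (rational points) is a Hodge class of
type `(0,0)`** (Deligne, LNM 900, I, Prop. 3.4 and its proof: `MT` is exactly the stabiliser of
the Hodge tensors and every `MT`-invariant tensor is of type `(0,0)`; Green–Griffiths–Kerr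
(I.B.1)). Read on `ℚ`-points via explicit rational unipotent and torus elements of `MT(ℚ)` (in
place of the density of `MT(ℚ)`, Borel 18.3). No weight hypothesis is needed (for
`(a - b) n ≠ 0` the homotheties in `MT(ℚ)` leave only `t = 0`).
[cite: Deligne1982HodgeCycles, I Prop. 3.4] -/
theorem mem_hodgeClasses_of_forall_mumfordTateGroup (H : HodgeStructure V n) {a b : ℕ}
    {t : hodgeTensorSpace V a b} (ht : ∀ g ∈ H.mumfordTateGroup, tensorSpaceAct g t = t) :
    t ∈ (H.tensorSpace a b).hodgeClasses 0 := by
  classical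
  by_contra hnot
  obtain ⟨X, hX, hXt⟩ := exists_mem_lieStabilizer_apply_ne_zero H hnot
  obtain ⟨N, S, hNnil, hSss, hXNS, hNmem, hSmem⟩ := exists_jordan_mem_lieStabilizer H hX
  rw [hXNS, map_add, LinearMap.add_apply] at hXt
  by_cases hNt : tensorDerivation a b N t = 0
  · -- the semisimple part moves `t`: use a rational torus element
    rw [hNt, zero_add] at hXt
    obtain ⟨ι, _, bb, ev, hbb⟩ := exists_eigenbasis_of_isSemisimple hSss
    -- `ρ(S_ℂ)` is diagonal in the tensor basis
    have hdiagS : ∀ x : (Fin a → ι) × (Fin b → ι),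
        tensorDerivation a b (S.baseChange ℂ) (hodgeTensorBasis bb a b x) =
          (∑ μ, tensorWeight ev x μ • (μ : ℂ)) • hodgeTensorBasis bb a b x := fun x => by
      rw [tensorDerivation_hodgeTensorBasis' bb hbb x,
        tensorDerivation_eigenvalue_eq_sum_tensorWeight ev (fun μ => (μ : ℂ)) x]
    have hne : tensorDerivation a b (S.baseChange ℂ) (tensorSpaceToBaseChange ℂ V a b t) ≠ 0 := by
      rw [← hodgeTensorSpaceBaseChange_one_tmul, ← hodgeTensorSpaceBaseChange_tensorDerivation,
        LinearMap.baseChange_tmul, hodgeTensorSpaceBaseChange_one_tmul]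
      exact fun h0 => hXt (tensorSpaceToBaseChange_injective V a b (by rw [h0, map_zero]))
    obtain ⟨x₀, hκ, hcoef⟩ := @exists_repr_ne_zero_of_diag_apply_ne_zero ℂ _
      (hodgeTensorSpaceOver ℂ (ℂ ⊗[ℚ] V) a b) _ _ ((Fin a → ι) × (Fin b → ι))
      (hodgeTensorBasis bb a b) (tensorDerivation a b (S.baseChange ℂ))
      (fun x => ∑ μ, tensorWeight ev x μ • (μ : ℂ)) hdiagS _ hne
    obtain ⟨g, U, hgMT, hgb, hU0, -, hsep⟩ := exists_torusElement H hSmem hSss bb ev hbb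
      {tensorWeight ev x₀} (by simpa using hκ)
    have hgt := congrArg (tensorSpaceToBaseChange ℂ V a b) (ht g hgMT)
    rw [tensorSpaceToBaseChange_tensorSpaceAct] at hgt
    have hgb' : ∀ i, (g.baseChange ℚ ℂ V V) (bb i) = U (ev i) • bb i := fun i => by
      change (g : V →ₗ[ℚ] V).baseChange ℂ (bb i) = _
      exact hgb i
    have hdiagG : ∀ x : (Fin a → ι) × (Fin b → ι),
        (tensorSpaceActOver (a := a) (b := b) (g.baseChange ℚ ℂ V V)).toLinearMap
            (hodgeTensorBasis bb a b x) =
          (∏ μ, U μ ^ tensorWeight ev x μ) • hodgeTensorBasis bb a b x := fun x => by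
      rw [tensorSpaceActOver_hodgeTensorBasis' bb hgb' x, prod_zpow_tensorWeight ev x hU0]
    have hrepr := @basisRepr_apply_of_diag ℂ _ (hodgeTensorSpaceOver ℂ (ℂ ⊗[ℚ] V) a b) _ _
      ((Fin a → ι) × (Fin b → ι)) (hodgeTensorBasis bb a b)
      (tensorSpaceActOver (a := a) (b := b) (g.baseChange ℚ ℂ V V)).toLinearMap
      (fun x => ∏ μ, U μ ^ tensorWeight ev x μ) hdiagG (tensorSpaceToBaseChange ℂ V a b t) x₀
    rw [LinearEquiv.coe_coe, hgt] at hrepr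
    have h1 : ∏ μ, U μ ^ tensorWeight ev x₀ μ = 1 :=
      mul_right_cancel₀ hcoef (hrepr.symm.trans (one_mul _).symm)
    exact hsep _ (Finset.mem_singleton_self _) h1
  · -- the nilpotent part moves `t`: use the unipotent `exp N`
    exact hNt (tensorDerivation_apply_eq_zero_of_fixed hNnil
      (ht _ (unipotentOfNilpotent_mem_mumfordTateGroup H hNmem hNnil)))

end HodgeStructure

end Literature.AlgebraicGeometry.Motives

end
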